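import Summits.QuantumFields.YangMills.Theses.SmallCircleAnchor

/-!
# The frozen-holonomy expectation functional of crux `AnchorGap` is well posed

Helpers for crux stmt-QuantumFields-11141 (`AnchorGap`, route `SmallCircleAnchor`), line
`registered` (`Cruxes/AnchorGap/Lines/birth.lean`), stub `stub_frozenHolonomyGap` (S). The stub
speaks about the FROZEN-HOLONOMY finite-temperature Wilson theory on `ℤ_T × (ℤ/L)³` through the
inline functional `Ex F := (∫ F · wgt ∂ν) / (∫ wgt ∂ν)`, `ν` = product Haar on the spatial links,
`wgt W = exp (act (ι W))` with `ι W` the completion of `W` by the frozen time-like links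
`(1, …, 1, g₀)`. This file proves, in exactly that vocabulary:

* an abstract layer (`ratioEx_abs_le_one`, `ratioEx_cov_abs_le_two`,
  `decay_bound_of_large_separation`) on ratio-of-integrals expectations with a weight pinched
  between two positive constants;
* `frozen_cov_abs_le_two`: the weight is continuous and pinched between `e^{∓B}`,
  `B = |β| · #plaquettes · N`, so every covariance of two `Loc` observables is `≤ 2` — for ALL
  `β`, `L`, `n` (the partition function is `≥ e^{-B} > 0`; `Ex` is an honest normalised
  expectation);
* `frozen_clustering_of_large_separation`: to prove the stub's volume-uniform bound
  `|Ex (F₁ · F₂∘σ_n) − Ex F₁ · Ex (F₂∘σ_n)| ≤ C e^{−m n}` for all `n` with `2n < L` it suffices to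
  prove it for separations `n > w` (where the two `w`-cubes carrying `F₁` and `F₂∘σ_n` are
  disjoint), at the price `C ↦ max C (2 e^{m w})`, uniformly in `L` and the base point.
-/

set_option autoImplicit false

noncomputable section

namespace Summit.QuantumFields.YangMills.Theorems.AnchorGap

open MeasureTheory
open Literature.MathematicalPhysics.QuantumFieldTheory

section Abstract

variable {Ω : Type*} [MeasurableSpace Ω] (ν : Measure Ω) [IsProbabilityMeasure ν]

/-- A measurable real function bounded in absolute value is integrable against a probability
measure. [folklore] -/
theorem integrable_of_abs_le {F : Ω → ℝ} {c : ℝ} (hFm : Measurable F) (hF : ∀ x, |F x| ≤ c) :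
    Integrable F ν :=
  (integrable_const c).mono' hFm.aestronglyMeasurable (Filter.Eventually.of_forall fun x => by
    simpa [Real.norm_eq_abs] using hF x)

/-- **Lower bound of the partition function.** If the weight is measurable and `a ≤ wgt ≤ b`
pointwise then `a ≤ ∫ wgt ∂ν` for a probability measure `ν`. [folklore] -/
theorem le_integral_weight {wgt : Ω → ℝ} {a b : ℝ} (hwm : Measurable wgt) (hwa : ∀ x, a ≤ wgt x)
    (hwb : ∀ x, wgt x ≤ b) : a ≤ ∫ x, wgt x ∂ν := by
  have hint : Integrable wgt ν :=
    integrable_of_abs_le ν hwm (c := max |a| |b|) fun x => by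
      rw [abs_le]
      constructor
      · have := hwa x
        have h1 : -max |a| |b| ≤ -|a| := by simp
        linarith [neg_abs_le a]
      · exact (hwb x).trans ((le_abs_self b).trans (le_max_right _ _))
  calc a = ∫ _x, a ∂ν := by simp
    _ ≤ ∫ x, wgt x ∂ν := integral_mono (integrable_const a) hint hwa

/-- **Numerator bound.** If `|F| ≤ 1`, `F` measurable, and `0 < a ≤ wgt ≤ b` measurable, then
`|∫ F · wgt ∂ν| ≤ ∫ wgt ∂ν`. [folklore] -/
theorem abs_integral_mul_weight_le {wgt F : Ω → ℝ} {a b : ℝ} (ha : 0 < a) (hwm : Measurable wgt)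
    (hwa : ∀ x, a ≤ wgt x) (hwb : ∀ x, wgt x ≤ b) (hFm : Measurable F) (hF : ∀ x, |F x| ≤ 1) :
    |∫ x, F x * wgt x ∂ν| ≤ ∫ x, wgt x ∂ν := by
  have hw0 : ∀ x, 0 ≤ wgt x := fun x => ha.le.trans (hwa x)
  have hwint : Integrable wgt ν :=
    integrable_of_abs_le ν hwm (c := b) fun x => by
      rw [abs_of_nonneg (hw0 x)]; exact hwb x
  have hFw : Integrable (fun x => F x * wgt x) ν :=
    integrable_of_abs_le ν (hFm.mul hwm) (c := b) fun x => by
      rw [abs_mul, abs_of_nonneg (hw0 x)]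
      calc |F x| * wgt x ≤ 1 * wgt x := by gcongr; exacts [hw0 x, hF x]
        _ = wgt x := one_mul _
        _ ≤ b := hwb x
  calc |∫ x, F x * wgt x ∂ν| ≤ ∫ x, |F x * wgt x| ∂ν := abs_integral_le_integral_abs
    _ ≤ ∫ x, wgt x ∂ν := by
        refine integral_mono hFw.abs hwint fun x => ?_
        show |F x * wgt x| ≤ wgt x
        rw [abs_mul, abs_of_nonneg (hw0 x)]
        calc |F x| * wgt x ≤ 1 * wgt x := by gcongr; exacts [hw0 x, hF x]
          _ = wgt x := one_mul _

/-- **`|Ex F| ≤ 1`** for the ratio-of-integrals expectation `Ex F = (∫ F·wgt ∂ν)/(∫ wgt ∂ν)` of an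
observable bounded by `1`, when the weight is measurable and pinched between two positive
constants. [folklore] -/
theorem ratioEx_abs_le_one {wgt F : Ω → ℝ} {a b : ℝ} (ha : 0 < a) (hwm : Measurable wgt)
    (hwa : ∀ x, a ≤ wgt x) (hwb : ∀ x, wgt x ≤ b) (hFm : Measurable F) (hF : ∀ x, |F x| ≤ 1) :
    |(∫ x, F x * wgt x ∂ν) / (∫ x, wgt x ∂ν)| ≤ 1 := by
  have hZ : 0 < ∫ x, wgt x ∂ν := ha.trans_le (le_integral_weight ν hwm hwa hwb)
  rw [abs_div, abs_of_pos hZ, div_le_one hZ]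
  exact abs_integral_mul_weight_le ν ha hwm hwa hwb hFm hF

/-- **Covariances of bounded observables are bounded by `2`**: with `Ex` as above,
`|Ex (F·G) − Ex F · Ex G| ≤ 2` for measurable `F, G` bounded by `1`. [folklore] -/
theorem ratioEx_cov_abs_le_two {wgt F F' : Ω → ℝ} {a b : ℝ} (ha : 0 < a) (hwm : Measurable wgt)
    (hwa : ∀ x, a ≤ wgt x) (hwb : ∀ x, wgt x ≤ b) (hFm : Measurable F) (hF : ∀ x, |F x| ≤ 1)
    (hF'm : Measurable F') (hF' : ∀ x, |F' x| ≤ 1) :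
    |(∫ x, (F x * F' x) * wgt x ∂ν) / (∫ x, wgt x ∂ν) -
        (∫ x, F x * wgt x ∂ν) / (∫ x, wgt x ∂ν) * ((∫ x, F' x * wgt x ∂ν) / (∫ x, wgt x ∂ν))| ≤
      2 := by
  have hm : Measurable (fun x => F x * F' x) := hFm.mul hF'm
  have hb : ∀ x, |F x * F' x| ≤ 1 := fun x => by
    rw [abs_mul]
    calc |F x| * |F' x| ≤ 1 * 1 := mul_le_mul (hF x) (hF' x) (abs_nonneg _) zero_le_one
      _ = 1 := one_mul (1 : ℝ)
  have h1 := ratioEx_abs_le_one ν ha hwm hwa hwb hm hb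
  have h2 := ratioEx_abs_le_one ν ha hwm hwa hwb hFm hF
  have h3 := ratioEx_abs_le_one ν ha hwm hwa hwb hF'm hF'
  calc _ ≤ |(∫ x, (F x * F' x) * wgt x ∂ν) / (∫ x, wgt x ∂ν)| +
        |(∫ x, F x * wgt x ∂ν) / (∫ x, wgt x ∂ν) * ((∫ x, F' x * wgt x ∂ν) / (∫ x, wgt x ∂ν))| :=
        abs_sub _ _
    _ ≤ 1 + 1 * 1 := by
        rw [abs_mul]
        exact add_le_add h1 (mul_le_mul h2 h3 (abs_nonneg _) zero_le_one)
    _ = 2 := by norm_num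

end Abstract

section Decay

/-- **Clustering only needs large separations.** If a real sequence is bounded by `2` in absolute
value and satisfies `|a n| ≤ C e^{−m n}` for all `n > w` (with `m ≥ 0`), then
`|a n| ≤ max C (2 e^{m w}) · e^{−m n}` for every `n`. [folklore] -/
theorem decay_bound_of_large_separation {a : ℕ → ℝ} {m C : ℝ} {w : ℕ} (hm : 0 ≤ m)
    (ha2 : ∀ n, |a n| ≤ 2) (hlarge : ∀ n, w < n → |a n| ≤ C * Real.exp (-(m * n))) (n : ℕ) :
    |a n| ≤ max C (2 * Real.exp (m * w)) * Real.exp (-(m * n)) := by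
  rcases lt_or_ge w n with hwn | hnw
  · calc |a n| ≤ C * Real.exp (-(m * n)) := hlarge n hwn
      _ ≤ max C (2 * Real.exp (m * w)) * Real.exp (-(m * n)) := by
          gcongr; exact le_max_left _ _
  · have hexp : (1 : ℝ) ≤ Real.exp (m * w) * Real.exp (-(m * n)) := by
      rw [← Real.exp_add]
      refine Real.one_le_exp ?_
      have : (n : ℝ) ≤ w := by exact_mod_cast hnw
      nlinarith
    calc |a n| ≤ 2 := ha2 n
      _ ≤ 2 * (Real.exp (m * w) * Real.exp (-(m * n))) := by nlinarith
      _ = (2 * Real.exp (m * w)) * Real.exp (-(m * n)) := by ring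
      _ ≤ max C (2 * Real.exp (m * w)) * Real.exp (-(m * n)) := by
          gcongr; exact le_max_right _ _

end Decay

section Frozen

/-- For a unitary lattice representation, `|Re tr r.ρ g| ≤ N`. [folklore] -/
theorem abs_trace_re_le (G : Type) [Group G] [TopologicalSpace G] (r : LatticeRep G) (g : G) :
    |(r.ρ g).trace.re| ≤ r.N := by
  calc |(r.ρ g).trace.re| ≤ ‖(r.ρ g).trace‖ := Complex.abs_re_le_norm _
    _ ≤ ∑ i, ‖(r.ρ g).diag i‖ := norm_sum_le _ _
    _ ≤ ∑ _i : Fin r.N, (1 : ℝ) :=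
        Finset.sum_le_sum fun i _ => entry_norm_bound_of_unitary (r.mem_unitary g) i i
    _ = r.N := by simp

/-- **Every covariance of the frozen-holonomy theory is at most `2`** (stub S vocabulary,
verbatim): for every compact `G` with a faithful unitary `r`, every `g₀`, `T ≥ 1`, EVERY real
`β`, every cube side `w`, every `L ≥ 1`, base point `c`, all `Loc` observables `F₁, F₂` and all
separations `n`, `|Ex (F₁ · F₂∘σ_n) − Ex F₁ · Ex (F₂∘σ_n)| ≤ 2`. Proof: the weight
`exp (act (ι W))` is continuous (finitely many continuous plaquette traces of a continuous
representation) hence measurable (the spatial configuration space is a finite product of the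
second-countable group `G`), and pinched between `e^{-B}` and `e^{B}`,
`B = |β| (∑_x ∑_i N + ∑_x ∑_{i<j} N)`; apply `ratioEx_cov_abs_le_two` w.r.t. the product Haar
probability measure. [folklore] -/
theorem frozen_cov_abs_le_two :
    ∀ (G : Type) [Group G] [TopologicalSpace G] [IsTopologicalGroup G] [CompactSpace G], letI : MeasurableSpace G := borel G; haveI : BorelSpace G := ⟨rfl⟩; ∀ (r : LatticeRep G) (g₀ : G) (T : ℕ) [NeZero T] (β : ℝ) (w : ℕ) (L : ℕ) [NeZero L], let St := ZMod T × (Fin 3 → ZMod L); let Cfg := St × Option (Fin 3) → G; let CfgS := St × Fin 3 → G; let ν : MeasureTheory.Measure CfgS := MeasureTheory.Measure.pi fun _ => haarProbability G; let ι : CfgS → Cfg := fun W p => Option.elim p.2 (if p.1.1 + 1 = 0 then g₀ else 1) fun i => W (p.1, i); let sh : St → Option (Fin 3) → St := fun x μ => Option.elim μ (x.1 + 1, x.2) fun i => (x.1, x.2 + Pi.single i 1); let pl : Cfg → St → Option (Fin 3) → Option (Fin 3) → G := fun U x μ κ => U (x, μ) * U (sh x μ, κ) * (U (sh x κ, μ))⁻¹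 * (U (x, κ))⁻¹; let act : Cfg → ℝ := fun U => β * ∑ x : St, ∑ i : Fin 3, (r.ρ (pl U x none (some i))).trace.re + β * ∑ x : St, ∑ q : {q : Fin 3 × Fin 3 // q.1 < q.2}, (r.ρ (pl U x (some q.1.1) (some q.1.2))).trace.re; let wgt : CfgS → ℝ := fun W => Real.exp (act (ι W)); let Ex : (CfgS → ℝ) → ℝ := fun F => (∫ W, F W * wgt W ∂ν) / (∫ W, wgt W ∂ν); let σ : ℕ → CfgS → CfgS := fun n W p => W ((p.1.1, p.1.2 + Pi.single 0 (n : ZMod L)), p.2); ∀ (c : Fin 3 → ZMod L), let Loc := fun F : CfgS → ℝ => Measurable F ∧ (∀ W, |F W| ≤ 1) ∧ ∀ W W', (∀ p, (∀ i : Fin 3, (p.1.2 i - c i).val ≤ w) → W p = W' p) → F W = F W'; ∀ F₁ F₂ : CfgS → ℝ, Loc F₁ → Loc F₂ → ∀ n : ℕ, |Ex (fun W => F₁ W * F₂ (σ n W)) - Ex F₁ * Ex (fun W => F₂ (σ n W))| ≤ 2 := by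
  intro G _ _ _ _
  letI : MeasurableSpace G := borel G
  haveI : BorelSpace G := ⟨rfl⟩
  intro r g₀ T _ β w L _ St Cfg CfgS ν ι sh pl act wgt Ex σ c Loc F₁ F₂ hF₁ hF₂ n
  haveI : SecondCountableTopology G :=
    (r.continuous.isClosedEmbedding r.injective).isEmbedding.secondCountableTopology
  haveI : IsProbabilityMeasure ν := by
    show IsProbabilityMeasure (Measure.pi fun _ : St × Fin 3 => haarProbability G)
    infer_instance
  -- continuity of the completion map and of the action
  have hι : Continuous ι := by
    refine continuous_pi fun p => ?_
    obtain ⟨x, μ⟩ := p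
    cases μ with
    | none => exact continuous_const
    | some i => exact continuous_apply (x, i)
  have hpl : ∀ (x : St) (μ κ : Option (Fin 3)), Continuous fun U : Cfg => pl U x μ κ := by
    intro x μ κ
    show Continuous fun U : Cfg => U (x, μ) * U (sh x μ, κ) * (U (sh x κ, μ))⁻¹ * (U (x, κ))⁻¹
    exact (((continuous_apply (x, μ)).mul (continuous_apply (sh x μ, κ))).mul
      (continuous_apply (sh x κ, μ)).inv).mul (continuous_apply (x, κ)).inv
  have htr : ∀ (x : St) (μ κ : Option (Fin 3)),
      Continuous fun U : Cfg => (r.ρ (pl U x μ κ)).trace.re := fun x μ κ =>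
    Complex.continuous_re.comp ((r.continuous.comp (hpl x μ κ)).matrix_trace)
  have hact : Continuous act := by
    refine (continuous_const.mul (continuous_finsetSum _ fun x _ =>
      continuous_finsetSum _ fun i _ => htr x none (some i))).add
      (continuous_const.mul (continuous_finsetSum _ fun x _ =>
        continuous_finsetSum _ fun q _ => htr x (some q.1.1) (some q.1.2)))
  have hwm : Measurable wgt := (Real.continuous_exp.comp (hact.comp hι)).measurable
  -- two-sided bounds of the weight
  set B : ℝ := |β| * ∑ _x : St, ∑ _i : Fin 3, (r.N : ℝ) +
    |β| * ∑ _x : St, ∑ _q : {q : Fin 3 × Fin 3 // q.1 < q.2}, (r.N : ℝ) with hB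
  have hactb : ∀ U : Cfg, |act U| ≤ B := by
    intro U
    have h1 : |∑ x : St, ∑ i : Fin 3, (r.ρ (pl U x none (some i))).trace.re| ≤
        ∑ _x : St, ∑ _i : Fin 3, (r.N : ℝ) := by
      refine (Finset.abs_sum_le_sum_abs _ _).trans (Finset.sum_le_sum fun x _ => ?_)
      exact (Finset.abs_sum_le_sum_abs _ _).trans (Finset.sum_le_sum fun i _ =>
        abs_trace_re_le G r _)
    have h2 : |∑ x : St, ∑ q : {q : Fin 3 × Fin 3 // q.1 < q.2},
        (r.ρ (pl U x (some q.1.1) (some q.1.2))).trace.re| ≤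
        ∑ _x : St, ∑ _q : {q : Fin 3 × Fin 3 // q.1 < q.2}, (r.N : ℝ) := by
      refine (Finset.abs_sum_le_sum_abs _ _).trans (Finset.sum_le_sum fun x _ => ?_)
      exact (Finset.abs_sum_le_sum_abs _ _).trans (Finset.sum_le_sum fun q _ =>
        abs_trace_re_le G r _)
    calc |act U| ≤ |β * ∑ x : St, ∑ i : Fin 3, (r.ρ (pl U x none (some i))).trace.re| +
          |β * ∑ x : St, ∑ q : {q : Fin 3 × Fin 3 // q.1 < q.2},
            (r.ρ (pl U x (some q.1.1) (some q.1.2))).trace.re| := abs_add_le _ _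
      _ ≤ B := by
          rw [abs_mul, abs_mul, hB]
          exact add_le_add (mul_le_mul_of_nonneg_left h1 (abs_nonneg β))
            (mul_le_mul_of_nonneg_left h2 (abs_nonneg β))
  have hwa : ∀ W : CfgS, Real.exp (-B) ≤ wgt W := fun W =>
    Real.exp_le_exp.2 (by linarith [neg_abs_le (act (ι W)), hactb (ι W)])
  have hwb : ∀ W : CfgS, wgt W ≤ Real.exp B := fun W =>
    Real.exp_le_exp.2 (by linarith [le_abs_self (act (ι W)), hactb (ι W)])
  -- the observables
  obtain ⟨hF₁m, hF₁b, -⟩ := hF₁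
  obtain ⟨hF₂m, hF₂b, -⟩ := hF₂
  have hσ : Measurable (σ n) := measurable_pi_lambda _ fun p => measurable_pi_apply _
  exact ratioEx_cov_abs_le_two ν (Real.exp_pos (-B)) hwm hwa hwb hF₁m hF₁b (hF₂m.comp hσ)
    fun W => hF₂b (σ n W)

/-- **Frozen-holonomy clustering only needs separations beyond the observable size** (stub S
vocabulary, verbatim): if, at given `β`, `m ≥ 0`, `w`, `C`, `L` and base point `c`, the bound
`|Ex (F₁ · F₂∘σ_n) − Ex F₁ · Ex (F₂∘σ_n)| ≤ C e^{−m n}` holds for all `Loc` observables and all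
separations `n > w` with `2n < L`, then it holds for ALL `n` with `2n < L` with the constant
`max C (2 e^{m w})` — which does not depend on `L` or `c`, so volume-uniformity is preserved.
(`frozen_cov_abs_le_two` + `decay_bound_of_large_separation`.) [folklore] -/
theorem frozen_clustering_of_large_separation :
    ∀ (G : Type) [Group G] [TopologicalSpace G] [IsTopologicalGroup G] [CompactSpace G], letI : MeasurableSpace G := borel G; haveI : BorelSpace G := ⟨rfl⟩; ∀ (r : LatticeRep G) (g₀ : G) (T : ℕ) [NeZero T] (β m : ℝ), 0 ≤ m → ∀ (w : ℕ) (C : ℝ) (L : ℕ) [NeZero L], let St := ZMod T × (Fin 3 → ZMod L); let Cfg := St × Option (Fin 3) → G; let CfgS := St × Fin 3 → G; let ν : MeasureTheory.Measure CfgS := MeasureTheory.Measure.pi fun _ => haarProbability G; let ι : CfgS → Cfg := fun W p => Option.elim p.2 (if p.1.1 + 1 = 0 then g₀ else 1) fun i => W (p.1, i); let sh : St → Option (Fin 3) → St := fun x μ => Option.elim μ (x.1 + 1, x.2) fun i => (x.1, x.2 + Pi.single i 1); let pl : Cfg → St → Option (Fin 3) → Option (Fin 3) → G := fun U x μ κ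 => U (x, μ) * U (sh x μ, κ) * (U (sh x κ, μ))⁻¹ * (U (x, κ))⁻¹; let act : Cfg → ℝ := fun U => β * ∑ x : St, ∑ i : Fin 3, (r.ρ (pl U x none (some i))).trace.re + β * ∑ x : St, ∑ q : {q : Fin 3 × Fin 3 // q.1 < q.2}, (r.ρ (pl U x (some q.1.1) (some q.1.2))).trace.re; let wgt : CfgS → ℝ := fun W => Real.exp (act (ι W)); let Ex : (CfgS → ℝ) → ℝ := fun F => (∫ W, F W * wgt W ∂ν) / (∫ W, wgt W ∂ν); let σ : ℕ → CfgS → CfgS := fun n W p => W ((p.1.1, p.1.2 + Pi.single 0 (n : ZMod L)), p.2); ∀ (c : Fin 3 → ZMod L), let Loc := fun F : CfgS → ℝ => Measurable F ∧ (∀ W, |F W| ≤ 1) ∧ ∀ W W', (∀ p, (∀ i : Fin 3, (p.1.2 i - c i).val ≤ w) → W p = W' p) → F W = F W'; (∀ F₁ F₂ : CfgS → ℝ, Loc F₁ → Loc F₂ → ∀ n : ℕ, w < n → 2 * n < L → |Ex (fun W => F₁ W * F₂ (σ n W)) - Ex F₁ * Ex (fun W => F₂ (σ n W))| ≤ C *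 Real.exp (-(m * n))) → ∀ F₁ F₂ : CfgS → ℝ, Loc F₁ → Loc F₂ → ∀ n : ℕ, 2 * n < L → |Ex (fun W => F₁ W * F₂ (σ n W)) - Ex F₁ * Ex (fun W => F₂ (σ n W))| ≤ max C (2 * Real.exp (m * w)) * Real.exp (-(m * n)) := by
  intro G _ _ _ _
  letI : MeasurableSpace G := borel G
  haveI : BorelSpace G := ⟨rfl⟩
  intro r g₀ T _ β m hm w C L _ St Cfg CfgS ν ι sh pl act wgt Ex σ c Loc hlarge F₁ F₂ hF₁ hF₂ n hn
  have h2 : ∀ k : ℕ, |Ex (fun W => F₁ W * F₂ (σ k W)) - Ex F₁ * Ex (fun W => F₂ (σ k W))| ≤ 2 :=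
    fun k => frozen_cov_abs_le_two G r g₀ T β w L c F₁ F₂ hF₁ hF₂ k
  by_cases hwn : w < n
  · calc |Ex (fun W => F₁ W * F₂ (σ n W)) - Ex F₁ * Ex (fun W => F₂ (σ n W))|
          ≤ C * Real.exp (-(m * n)) := hlarge F₁ F₂ hF₁ hF₂ n hwn hn
      _ ≤ max C (2 * Real.exp (m * w)) * Real.exp (-(m * n)) := by
          gcongr; exact le_max_left _ _
  · have hnw : n ≤ w := Nat.le_of_not_lt hwn
    have hexp : (1 : ℝ) ≤ Real.exp (m * w) * Real.exp (-(m * n)) := by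
      rw [← Real.exp_add]
      refine Real.one_le_exp ?_
      have : (n : ℝ) ≤ w := by exact_mod_cast hnw
      nlinarith
    calc |Ex (fun W => F₁ W * F₂ (σ n W)) - Ex F₁ * Ex (fun W => F₂ (σ n W))| ≤ 2 := h2 n
      _ ≤ 2 * (Real.exp (m * w) * Real.exp (-(m * n))) := by nlinarith
      _ = (2 * Real.exp (m * w)) * Real.exp (-(m * n)) := by ring
      _ ≤ max C (2 * Real.exp (m * w)) * Real.exp (-(m * n)) := by
          gcongr; exact le_max_right _ _

end Frozen

end Summit.QuantumFields.YangMills.Theorems.AnchorGap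

end
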